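import Mathlib.Analysis.SpecialFunctions.Integrability.Basic
import Mathlib.Analysis.SpecialFunctions.Trigonometric.InverseDeriv
import Mathlib.Analysis.SpecialFunctions.Sqrt
import Mathlib.MeasureTheory.Integral.IntervalIntegral.FundThmCalculus
import Mathlib.MeasureTheory.Measure.WithDensity
import Mathlib.MeasureTheory.Integral.Bochner.ContinuousLinearMap
import HarnessLib

/-!
# The Kesten–McKay (Serre) law of Hecke eigenvalues and its logarithmic potential

Serre proved that for a fixed prime `ℓ` the eigenvalues of the normalised Hecke operator
`T'_ℓ = T_ℓ / ℓ^{(k-1)/2}` on `S_k(Γ₀(N))`, `ℓ ∤ N`, become equidistributed as `N + k → ∞` in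
`[-2, 2]` with respect to `μ_ℓ = ((ℓ+1)/π) (1 - x²/4)^{1/2} dx / ((ℓ^{1/2} + ℓ^{-1/2})² - x²)`
(Serre 1997, n° 3.2 Thm 1; `μ_q = f_q μ_∞` is defined for real `q > 1` in n° 2.3 (17)–(18) and
stated there to be positive of mass `1`; restated in Murty–Sinha 2009, §1 Thm 1, p. 682).
`μ_q` is also the Kesten–McKay (Plancherel) measure of the `(q+1)`-regular tree (loc. cit.).
In weight `2` one works with the UNNORMALISED eigenvalues `t = √ℓ x ∈ [-2√ℓ, 2√ℓ]`; pushing `μ_ℓ`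
forward under `x ↦ √ℓ x` gives the density `ρ_ℓ(t) = (ℓ+1) √(4ℓ - t²) / (2π ((ℓ+1)² - t²))`.

## Main definitions (namespace `Literature.NumberTheory.EllipticCurves.ModularForms`)

* `kestenMcKayDensity ℓ t = ρ_ℓ(t)` (zero off `[-2√ℓ, 2√ℓ]` since `Real.sqrt` of a negative
  number is `0`); `kestenMcKayMeasure ℓ = ρ_ℓ(t) dt` on `ℝ`;
* `kestenMcKayPotential ℓ a = ∫_{-2√ℓ}^{2√ℓ} log |a - t| ρ_ℓ(t) dt`, the logarithmic potential
  (sign convention `+log |a - t|`, i.e. minus the `U^μ` of Saff–Totik);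
* `serreHeckeDensity q x` : Serre's density in the normalised variable `x ∈ [-2, 2]`, as printed.

## Main results

* `kestenMcKayDensity_nonneg`, `_neg` (even), `_eq_zero` (support), `_eq_max_form`,
  `continuous_kestenMcKayDensity` and `kestenMcKayDensity_le` (continuity on `ℝ`, bound; `ℓ ≥ 2`);
* `integral_kestenMcKayDensity` : `∫_{-2√ℓ}^{2√ℓ} ρ_ℓ = 1` (`ℓ ≥ 2`) via the antiderivative
  `(1/2π) ((ℓ+1) arcsin (t/2√ℓ) - (ℓ-1) arcsin ((ℓ-1) t / (2√ℓ √((ℓ+1)²-t²))))`;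
  `isProbabilityMeasure_kestenMcKayMeasure`, `integral_kestenMcKayMeasure`;
* `kestenMcKayDensity_eq_serreHeckeDensity` : `ρ_ℓ(t) = serreHeckeDensity ℓ (t/√ℓ) / √ℓ`;
* `intervalIntegrable_log_mul_kestenMcKayDensity` (the potential is an honest integral),
  `kestenMcKayPotential_eq_integral`, `kestenMcKayPotential_neg` (the potential is even).

Not here: Serre's equidistribution theorem itself, its effective form (Murty–Sinha 2009, Thm 2),
and the continuity of the potential in `a`.

## References

* J.-P. Serre, Répartition asymptotique des valeurs propres de l'opérateur de Hecke `T_p`,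
  J. Amer. Math. Soc. 10 (1997), 75–102, n° 2.3, n° 3.2 Thm 1. [SerreHeckeEquidistribution1997]
* M. R. Murty, K. Sinha, Effective equidistribution of eigenvalues of Hecke operators,
  J. Number Theory 129 (2009), 681–714, §1 Thm 1–2.  [MurtySinha2009]
-/

noncomputable section
open MeasureTheory Set intervalIntegral

namespace Literature.NumberTheory.EllipticCurves.ModularForms

/-! ### The density -/

/-- The Kesten–McKay / Serre density in the unnormalised variable `t ∈ [-2√ℓ, 2√ℓ]`:
`ρ_ℓ(t) = (ℓ+1) √(4ℓ - t²) / (2π ((ℓ+1)² - t²))`.  Off the support `Real.sqrt (4ℓ - t²) = 0`, so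
`ρ_ℓ(t) = 0` for `t² ≥ 4ℓ` (in particular at the zeros `t = ±(ℓ+1)` of the denominator, where
Lean's `x / 0 = 0` is also the right value).  For `ℓ ≥ 2` the denominator is `≥ 2π(ℓ-1)² > 0` on the
support.  This is the push-forward under `x ↦ √ℓ x` of Serre's measure `μ_ℓ` on `[-2, 2]`
(`kestenMcKayDensity_eq_serreHeckeDensity`).
[cite: SerreHeckeEquidistribution1997, n° 2.3 (17)–(18) and n° 3.2 Thm 1] -/
def kestenMcKayDensity (ℓ : ℕ) (t : ℝ) : ℝ :=
  ((ℓ : ℝ) + 1) * Real.sqrt (4 * ℓ - t ^ 2) / (2 * Real.pi * (((ℓ : ℝ) + 1) ^ 2 - t ^ 2))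

/-- The Kesten–McKay / Serre law `ρ_ℓ(t) dt` as a measure on `ℝ` (Lebesgue measure with density
`ρ_ℓ`); a probability measure for `ℓ ≥ 2` (`isProbabilityMeasure_kestenMcKayMeasure`).
[cite: SerreHeckeEquidistribution1997, n° 2.3 (17)–(18) and n° 3.2 Thm 1] -/
def kestenMcKayMeasure (ℓ : ℕ) : Measure ℝ :=
  volume.withDensity fun t => ENNReal.ofReal (kestenMcKayDensity ℓ t)

/-- The logarithmic potential of the Kesten–McKay / Serre law,
`U_ℓ(a) = ∫_{-2√ℓ}^{2√ℓ} log |a - t| ρ_ℓ(t) dt` (note the sign: this is `-U^{μ}(a)` in the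
convention `U^μ(z) = ∫ log (1/|z-t|) dμ` of logarithmic potential theory).  For `ℓ ≥ 2` the
integrand is interval integrable for every `a` (`intervalIntegrable_log_mul_kestenMcKayDensity`),
so this is an honest integral. [folklore] -/
def kestenMcKayPotential (ℓ : ℕ) (a : ℝ) : ℝ :=
  ∫ t in (-(2 * Real.sqrt ℓ))..(2 * Real.sqrt ℓ), Real.log |a - t| * kestenMcKayDensity ℓ t

/-- Serre's density in the normalised variable `x ∈ [-2, 2]`, as printed: for real `q > 1`,
`μ_q = f_q μ_∞` with `f_q(x) = (q+1) / ((q^{1/2} + q^{-1/2})² - x²)` and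
`μ_∞ = (1/π) √(1 - x²/4) dx` (Sato–Tate), i.e.
`μ_q = ((q+1)/π) · (1 - x²/4)^{1/2} / ((q^{1/2} + q^{-1/2})² - x²) dx` (so restated in
Murty–Sinha 2009, §1 Thm 1, p. 682); we write `q^{1/2} = Real.sqrt q`, `q^{-1/2} = (Real.sqrt q)⁻¹`.
[cite: SerreHeckeEquidistribution1997, n° 2.3 (17)–(18)] -/
def serreHeckeDensity (q : ℝ) (x : ℝ) : ℝ :=
  (q + 1) / Real.pi * Real.sqrt (1 - x ^ 2 / 4) / ((Real.sqrt q + (Real.sqrt q)⁻¹) ^ 2 - x ^ 2)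

/-- Unfolding lemma for `kestenMcKayPotential`. [folklore] -/
theorem kestenMcKayPotential_def (ℓ : ℕ) (a : ℝ) : kestenMcKayPotential ℓ a =
    ∫ t in (-(2 * Real.sqrt ℓ))..(2 * Real.sqrt ℓ),
      Real.log |a - t| * kestenMcKayDensity ℓ t := rfl

/-- The density is nonnegative (for every `ℓ` and `t`). [folklore] -/
theorem kestenMcKayDensity_nonneg (ℓ : ℕ) (t : ℝ) : 0 ≤ kestenMcKayDensity ℓ t := by
  unfold kestenMcKayDensity
  by_cases h : t ^ 2 < ((ℓ : ℝ) + 1) ^ 2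
  · exact div_nonneg (mul_nonneg (by positivity) (Real.sqrt_nonneg _))
      (mul_nonneg (by positivity) (by linarith))
  · have hs : Real.sqrt (4 * ℓ - t ^ 2) = 0 := by
      apply Real.sqrt_eq_zero'.2
      push Not at h
      nlinarith [sq_nonneg ((ℓ : ℝ) - 1)]
    simp [hs]

/-- The density is even. [folklore] -/
theorem kestenMcKayDensity_neg (ℓ : ℕ) (t : ℝ) :
    kestenMcKayDensity ℓ (-t) = kestenMcKayDensity ℓ t := by
  simp only [kestenMcKayDensity, neg_sq]

/-- The density vanishes off the open support, i.e. for `4ℓ ≤ t²`. [folklore] -/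
theorem kestenMcKayDensity_eq_zero {ℓ : ℕ} {t : ℝ} (h : 4 * (ℓ : ℝ) ≤ t ^ 2) :
    kestenMcKayDensity ℓ t = 0 := by
  simp [kestenMcKayDensity, Real.sqrt_eq_zero'.2 (sub_nonpos.2 h)]

/-- The density vanishes for `2√ℓ ≤ |t|`. [folklore] -/
theorem kestenMcKayDensity_eq_zero_of_le_abs {ℓ : ℕ} {t : ℝ} (h : 2 * Real.sqrt ℓ ≤ |t|) :
    kestenMcKayDensity ℓ t = 0 := by
  apply kestenMcKayDensity_eq_zero
  have h2 : (2 * Real.sqrt ℓ) ^ 2 ≤ |t| ^ 2 := pow_le_pow_left₀ (by positivity) h 2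
  rw [mul_pow, Real.sq_sqrt (Nat.cast_nonneg _), sq_abs] at h2
  linarith

/-- The density written with a denominator that is bounded below:
`ρ_ℓ(t) = (ℓ+1) √(4ℓ - t²) / (2π · max ((ℓ+1)² - t², (ℓ-1)²))`.  (On the support
`(ℓ+1)² - t² ≥ (ℓ+1)² - 4ℓ = (ℓ-1)²`; off the support both sides vanish.) [folklore] -/
theorem kestenMcKayDensity_eq_max_form (ℓ : ℕ) (t : ℝ) : kestenMcKayDensity ℓ t =
    ((ℓ : ℝ) + 1) * Real.sqrt (4 * ℓ - t ^ 2) /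
      (2 * Real.pi * max (((ℓ : ℝ) + 1) ^ 2 - t ^ 2) (((ℓ : ℝ) - 1) ^ 2)) := by
  unfold kestenMcKayDensity
  by_cases h : t ^ 2 ≤ 4 * ℓ
  · rw [max_eq_left]
    nlinarith
  · have hs : Real.sqrt (4 * ℓ - t ^ 2) = 0 := Real.sqrt_eq_zero'.2 (by linarith)
    simp [hs]

/-- For `ℓ ≥ 2` the density is continuous on all of `ℝ`. [folklore] -/
theorem continuous_kestenMcKayDensity {ℓ : ℕ} (hℓ : 2 ≤ ℓ) :
    Continuous (kestenMcKayDensity ℓ) := by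
  have h2 : (2 : ℝ) ≤ ℓ := by exact_mod_cast hℓ
  rw [show kestenMcKayDensity ℓ = fun t => ((ℓ : ℝ) + 1) * Real.sqrt (4 * ℓ - t ^ 2) /
      (2 * Real.pi * max (((ℓ : ℝ) + 1) ^ 2 - t ^ 2) (((ℓ : ℝ) - 1) ^ 2)) from
    funext (kestenMcKayDensity_eq_max_form ℓ)]
  refine Continuous.div (by fun_prop) (by fun_prop) fun t => ?_
  have : 0 < ((ℓ : ℝ) - 1) ^ 2 := by nlinarith
  exact (mul_pos (by positivity) (lt_of_lt_of_le this (le_max_right _ _))).ne'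

/-- For `ℓ ≥ 2` the density is bounded: `ρ_ℓ(t) ≤ (ℓ+1) · 2√ℓ / (2π (ℓ-1)²)`. [folklore] -/
theorem kestenMcKayDensity_le {ℓ : ℕ} (hℓ : 2 ≤ ℓ) (t : ℝ) : kestenMcKayDensity ℓ t ≤
    ((ℓ : ℝ) + 1) * (2 * Real.sqrt ℓ) / (2 * Real.pi * ((ℓ : ℝ) - 1) ^ 2) := by
  have h2 : (2 : ℝ) ≤ ℓ := by exact_mod_cast hℓ
  have hpos : 0 < ((ℓ : ℝ) - 1) ^ 2 := by nlinarith
  rw [kestenMcKayDensity_eq_max_form]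
  refine div_le_div₀ (by positivity) ?_ (by positivity) ?_
  · refine mul_le_mul_of_nonneg_left ?_ (by positivity)
    calc Real.sqrt (4 * ℓ - t ^ 2) ≤ Real.sqrt (4 * ℓ) := Real.sqrt_le_sqrt (by nlinarith)
      _ = 2 * Real.sqrt ℓ := by
        rw [Real.sqrt_mul (by norm_num), show (4 : ℝ) = 2 ^ 2 by norm_num,
          Real.sqrt_sq (by norm_num)]
  · exact mul_le_mul_of_nonneg_left (le_max_right _ _) (by positivity)

/-! ### Total mass one -/

/-- **Total mass one.**  For `ℓ ≥ 2`, `∫_{-2√ℓ}^{2√ℓ} ρ_ℓ(t) dt = 1` ("la mesure `μ_q` est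
positive de masse 1", Serre, n° 2.3).  Proof: on `(-2√ℓ, 2√ℓ)` the function
`H(t) = (1/2π) ((ℓ+1) arcsin (t / 2√ℓ) - (ℓ-1) arcsin ((ℓ-1) t / (2√ℓ · √((ℓ+1)² - t²))))`
has derivative `ρ_ℓ`, it is continuous on the closed interval, and `H(±2√ℓ) = ±1/2`.
[cite: SerreHeckeEquidistribution1997, n° 2.3] -/
theorem integral_kestenMcKayDensity {ℓ : ℕ} (hℓ : 2 ≤ ℓ) :
    ∫ t in (-(2 * Real.sqrt ℓ))..(2 * Real.sqrt ℓ), kestenMcKayDensity ℓ t = 1 := by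
  simp only [kestenMcKayDensity]
  set L : ℝ := (ℓ : ℝ) with hL
  have hL2 : (2 : ℝ) ≤ L := by rw [hL]; exact_mod_cast hℓ
  set r : ℝ := Real.sqrt L with hr
  have hr0 : 0 < r := Real.sqrt_pos.2 (by linarith)
  have hrr : r ^ 2 = L := Real.sq_sqrt (by linarith)
  set A : ℝ := L + 1 with hA
  have hA0 : 0 < A := by rw [hA]; linarith
  have hL0 : L ≠ 0 := (by linarith : (0 : ℝ) < L).ne'
  -- positivity of `A² - t²` on the closed interval
  have hQpos : ∀ t ∈ Icc (-(2 * r)) (2 * r), 0 < A ^ 2 - t ^ 2 := by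
    intro t ht
    obtain ⟨h1, h2⟩ := ht
    have ht2 : t ^ 2 ≤ (2 * r) ^ 2 := by nlinarith
    rw [mul_pow, hrr] at ht2
    rw [hA]
    nlinarith
  -- the antiderivative
  set F : ℝ → ℝ := fun t => (1 / (2 * Real.pi)) * (A * Real.arcsin (t / (2 * r)) -
      (L - 1) * Real.arcsin ((L - 1) * t / (2 * r * Real.sqrt (A ^ 2 - t ^ 2)))) with hF
  have hcont : ContinuousOn F (Icc (-(2 * r)) (2 * r)) := by
    rw [hF]
    apply ContinuousOn.mul continuousOn_const
    apply ContinuousOn.sub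
    · exact continuousOn_const.mul
        (Real.continuous_arcsin.comp_continuousOn (continuousOn_id.div_const _))
    · apply continuousOn_const.mul
      apply Real.continuous_arcsin.comp_continuousOn
      refine ContinuousOn.div (by fun_prop) (by fun_prop) ?_
      intro t ht
      exact mul_ne_zero (by positivity) (Real.sqrt_pos.2 (hQpos t ht)).ne'
  have hint : IntervalIntegrable (fun t => A * Real.sqrt (4 * L - t ^ 2) /
      (2 * Real.pi * (A ^ 2 - t ^ 2))) volume (-(2 * r)) (2 * r) := by
    apply ContinuousOn.intervalIntegrable
    rw [uIcc_of_le (by linarith)]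
    refine ContinuousOn.div (by fun_prop) (by fun_prop) ?_
    intro t ht
    exact mul_ne_zero (by positivity) (hQpos t ht).ne'
  have hderiv : ∀ t ∈ Ioo (-(2 * r)) (2 * r),
      HasDerivAt F (A * Real.sqrt (4 * L - t ^ 2) / (2 * Real.pi * (A ^ 2 - t ^ 2))) t := by
    intro t ht
    obtain ⟨ht1, ht2⟩ := ht
    have ht4 : t ^ 2 < 4 * L := by nlinarith [hrr]
    set S : ℝ := Real.sqrt (4 * L - t ^ 2) with hS
    have hS0 : 0 < S := Real.sqrt_pos.2 (by linarith)
    have hSS : S ^ 2 = 4 * L - t ^ 2 := Real.sq_sqrt (by linarith)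
    have hq2 : 0 < A ^ 2 - t ^ 2 := hQpos t ⟨ht1.le, ht2.le⟩
    set q : ℝ := Real.sqrt (A ^ 2 - t ^ 2) with hq
    have hq0 : 0 < q := Real.sqrt_pos.2 hq2
    have hqq : q ^ 2 = A ^ 2 - t ^ 2 := Real.sq_sqrt hq2.le
    have hr0' : r ≠ 0 := hr0.ne'; have hS0' : S ≠ 0 := hS0.ne'; have hq0' : q ≠ 0 := hq0.ne'
    -- first arcsin
    have h1 : HasDerivAt (fun s => Real.arcsin (s / (2 * r))) (1 / S) t := by
      have hg : HasDerivAt (fun s => s / (2 * r)) (1 / (2 * r)) t := by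
        simpa using (hasDerivAt_id t).div_const (2 * r)
      have hlt1 : t / (2 * r) < 1 := (div_lt_one (by positivity)).2 ht2
      have hlt2 : -1 < t / (2 * r) := by
        rw [neg_lt, ← neg_div, div_lt_one (by positivity)]; linarith
      have hsq : Real.sqrt (1 - (t / (2 * r)) ^ 2) = S / (2 * r) := by
        have e : 1 - (t / (2 * r)) ^ 2 = (S / (2 * r)) ^ 2 := by
          rw [div_pow, div_pow, mul_pow, hrr, hSS]
          field_simp
          ring
        rw [e, Real.sqrt_sq (by positivity)]
      have := (Real.hasDerivAt_arcsin hlt2.ne' hlt1.ne).comp t hg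
      refine this.congr_deriv ?_
      rw [hsq]; field_simp
    -- second arcsin
    have h2 : HasDerivAt (fun s => Real.arcsin ((L - 1) * s / (2 * r * Real.sqrt (A ^ 2 - s ^ 2))))
        ((L - 1) * A / ((A ^ 2 - t ^ 2) * S)) t := by
      have hQd : HasDerivAt (fun s => Real.sqrt (A ^ 2 - s ^ 2)) (-(2 * t) / (2 * q)) t := by
        have hp : HasDerivAt (fun s => A ^ 2 - s ^ 2) (-(2 * t)) t := by
          simpa using (hasDerivAt_pow 2 t).const_sub (A ^ 2)
        exact hp.sqrt hq2.ne'
      have hden : HasDerivAt (fun s => 2 * r * Real.sqrt (A ^ 2 - s ^ 2))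
          (2 * r * (-(2 * t) / (2 * q))) t := hQd.const_mul (2 * r)
      have hnum : HasDerivAt (fun s => (L - 1) * s) ((L - 1) * 1) t :=
        (hasDerivAt_id t).const_mul (L - 1)
      have hg := hnum.div hden (mul_ne_zero (by positivity) hq0')
      have key : (2 * r * q) ^ 2 - ((L - 1) * t) ^ 2 = A ^ 2 * (4 * L - t ^ 2) := by
        rw [mul_pow, mul_pow, mul_pow, hqq, hrr, hA]; ring
      have hg2 : ((L - 1) * t / (2 * r * q)) ^ 2 < 1 := by
        rw [div_pow, div_lt_one (by positivity)]
        nlinarith [key, mul_pos (pow_pos hA0 2) (sub_pos.2 ht4)]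
      have hglt := abs_lt.1 ((sq_lt_one_iff_abs_lt_one _).1 hg2)
      have hsq : Real.sqrt (1 - ((L - 1) * t / (2 * r * q)) ^ 2) = A * S / (2 * r * q) := by
        have e : 1 - ((L - 1) * t / (2 * r * q)) ^ 2 = (A * S / (2 * r * q)) ^ 2 := by
          rw [div_pow, div_pow, mul_pow A S, hSS, ← key]
          field_simp
        rw [e, Real.sqrt_sq (by positivity)]
      have hAq : q ^ 2 + t ^ 2 = A ^ 2 := by linarith [hqq]
      have hsq' : Real.sqrt (1 - ((L - 1) * t / (2 * r * q)) ^ 2) =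
          (q ^ 2 + t ^ 2) * S / (2 * r * q * A) := by
        rw [hsq, hAq]; field_simp
      have := (Real.hasDerivAt_arcsin hglt.1.ne' hglt.2.ne).comp t hg
      refine this.congr_deriv ?_
      rw [hsq', ← hq, ← hqq]; field_simp; ring
    have hF' := ((h1.const_mul A).sub (h2.const_mul (L - 1))).const_mul (1 / (2 * Real.pi))
    refine hF'.congr_deriv ?_
    field_simp; rw [hSS, hA]; ring
  rw [integral_eq_sub_of_hasDerivAt_of_le (by linarith) hcont hderiv hint]
  -- evaluate the antiderivative at the endpoints
  have e2 : Real.sqrt (A ^ 2 - (2 * r) ^ 2) = L - 1 := by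
    rw [show A ^ 2 - (2 * r) ^ 2 = (L - 1) ^ 2 by rw [mul_pow, hrr, hA]; ring]
    exact Real.sqrt_sq (by linarith)
  have hL1 : L - 1 ≠ 0 := (by linarith : (0 : ℝ) < L - 1).ne'
  have e1 : (2 * r) / (2 * r) = 1 := div_self (by positivity)
  have e3 : (L - 1) * (2 * r) / (2 * r * (L - 1)) = 1 := by
    rw [mul_comm (2 * r) (L - 1)]; exact div_self (mul_ne_zero hL1 (by positivity))
  simp only [hF, neg_div, even_two.neg_pow, mul_neg, e1, e2, e3, Real.arcsin_neg, Real.arcsin_one]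
  field_simp
  ring

/-! ### The measure -/

/-- The density vanishes off the closed interval `[-2√ℓ, 2√ℓ]`. [folklore] -/
theorem kestenMcKayDensity_eq_zero_of_not_mem {ℓ : ℕ} {t : ℝ}
    (ht : t ∉ Icc (-(2 * Real.sqrt ℓ)) (2 * Real.sqrt ℓ)) : kestenMcKayDensity ℓ t = 0 := by
  apply kestenMcKayDensity_eq_zero_of_le_abs
  simp only [mem_Icc, not_and_or, not_le] at ht
  have h0 : 0 ≤ 2 * Real.sqrt ℓ := by positivity
  rcases ht with h | h
  · rw [abs_of_neg (by linarith)]; linarith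
  · rw [abs_of_pos (by linarith)]; exact h.le

/-- For `ℓ ≥ 2` the density is integrable on `ℝ`. [folklore] -/
theorem integrable_kestenMcKayDensity {ℓ : ℕ} (hℓ : 2 ≤ ℓ) :
    Integrable (kestenMcKayDensity ℓ) volume :=
  (continuous_kestenMcKayDensity hℓ).integrable_of_hasCompactSupport
    (HasCompactSupport.intro isCompact_Icc fun _ ht => kestenMcKayDensity_eq_zero_of_not_mem ht)

/-- Integration against the Kesten–McKay / Serre measure is integration against the density over
`[-2√ℓ, 2√ℓ]`: `∫ f dμ_ℓ = ∫_{-2√ℓ}^{2√ℓ} f(t) ρ_ℓ(t) dt` (for every `f`; both sides are `0` when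
`f ρ_ℓ` is not integrable). [folklore] -/
theorem integral_kestenMcKayMeasure {ℓ : ℕ} (hℓ : 2 ≤ ℓ) (f : ℝ → ℝ) :
    ∫ t, f t ∂(kestenMcKayMeasure ℓ) =
      ∫ t in (-(2 * Real.sqrt ℓ))..(2 * Real.sqrt ℓ), f t * kestenMcKayDensity ℓ t := by
  rw [kestenMcKayMeasure, integral_withDensity_eq_integral_toReal_smul
    ((continuous_kestenMcKayDensity hℓ).measurable.ennreal_ofReal)
    (Filter.Eventually.of_forall fun _ => ENNReal.ofReal_lt_top)]
  simp only [ENNReal.toReal_ofReal (kestenMcKayDensity_nonneg ℓ _), smul_eq_mul]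
  rw [intervalIntegral.integral_of_le (by linarith [Real.sqrt_nonneg (ℓ : ℝ)]),
    ← integral_Icc_eq_integral_Ioc, setIntegral_eq_integral_of_forall_compl_eq_zero]
  · exact integral_congr_ae (Filter.Eventually.of_forall fun t => mul_comm _ _)
  · intro t ht
    simp [kestenMcKayDensity_eq_zero_of_not_mem ht]

/-- For `ℓ ≥ 2` the Kesten–McKay / Serre law is a probability measure ("la mesure `μ_q` est
positive de masse 1 pour tout `q ≥ 1`"). [cite: SerreHeckeEquidistribution1997, n° 2.3] -/
theorem isProbabilityMeasure_kestenMcKayMeasure {ℓ : ℕ} (hℓ : 2 ≤ ℓ) :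
    IsProbabilityMeasure (kestenMcKayMeasure ℓ) := by
  constructor
  rw [kestenMcKayMeasure, withDensity_apply _ MeasurableSet.univ, Measure.restrict_univ,
    ← ofReal_integral_eq_lintegral_ofReal (integrable_kestenMcKayDensity hℓ)
      (Filter.Eventually.of_forall (kestenMcKayDensity_nonneg ℓ)),
    ← setIntegral_eq_integral_of_forall_compl_eq_zero
      (fun _ ht => kestenMcKayDensity_eq_zero_of_not_mem ht),
    integral_Icc_eq_integral_Ioc,
    ← intervalIntegral.integral_of_le (by linarith [Real.sqrt_nonneg (ℓ : ℝ)]),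
    integral_kestenMcKayDensity hℓ, ENNReal.ofReal_one]

/-! ### Relation to Serre's normalised density -/

/-- `ρ_ℓ` is Serre's `μ_ℓ` transported to the unnormalised variable `t = √ℓ x`:
`ρ_ℓ(t) = serreHeckeDensity ℓ (t / √ℓ) / √ℓ` for every `ℓ ≥ 1` and every `t` (both sides vanish
for `t² ≥ 4ℓ`, including at the common zero `t = ±(ℓ+1)` of the denominators).
[cite: SerreHeckeEquidistribution1997, n° 2.3 (17)–(18)] -/
theorem kestenMcKayDensity_eq_serreHeckeDensity {ℓ : ℕ} (hℓ : 1 ≤ ℓ) (t : ℝ) :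
    kestenMcKayDensity ℓ t = serreHeckeDensity ℓ (t / Real.sqrt ℓ) / Real.sqrt ℓ := by
  unfold kestenMcKayDensity serreHeckeDensity
  set r : ℝ := Real.sqrt ℓ with hr
  have hr0 : 0 < r := Real.sqrt_pos.2 (by exact_mod_cast hℓ)
  have hr0' : r ≠ 0 := hr0.ne'
  have hrr : (ℓ : ℝ) = r ^ 2 := (Real.sq_sqrt (Nat.cast_nonneg _)).symm
  rw [hrr]
  have h1 : Real.sqrt (1 - (t / r) ^ 2 / 4) = Real.sqrt (4 * r ^ 2 - t ^ 2) / (2 * r) := by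
    have e : 1 - (t / r) ^ 2 / 4 = (4 * r ^ 2 - t ^ 2) / (2 * r) ^ 2 := by
      field_simp
      ring
    rw [e, Real.sqrt_div' _ (by positivity), Real.sqrt_sq (by positivity)]
  have hD' : (r + r⁻¹) ^ 2 - (t / r) ^ 2 = ((r ^ 2 + 1) ^ 2 - t ^ 2) / r ^ 2 := by
    field_simp
  rw [h1, hD']
  by_cases hD : (r ^ 2 + 1) ^ 2 - t ^ 2 = 0
  · rw [hD, mul_zero, div_zero, zero_div, div_zero, zero_div]
  · field_simp

/-! ### The logarithmic potential -/

/-- For `ℓ ≥ 2` and every `a`, the integrand `t ↦ log |a - t| ρ_ℓ(t)` of the potential is interval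
integrable on `[-2√ℓ, 2√ℓ]` (the logarithm is interval integrable on every interval and `ρ_ℓ` is
continuous). [folklore] -/
theorem intervalIntegrable_log_mul_kestenMcKayDensity {ℓ : ℕ} (hℓ : 2 ≤ ℓ) (a : ℝ) :
    IntervalIntegrable (fun t => Real.log |a - t| * kestenMcKayDensity ℓ t) volume
      (-(2 * Real.sqrt ℓ)) (2 * Real.sqrt ℓ) := by
  have h : IntervalIntegrable (fun t => Real.log (a - t)) volume
      (-(2 * Real.sqrt ℓ)) (2 * Real.sqrt ℓ) := by
    have := (intervalIntegral.intervalIntegrable_log' (a := a - -(2 * Real.sqrt ℓ))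
      (b := a - 2 * Real.sqrt ℓ)).comp_sub_left a
    simpa only [sub_sub_cancel] using this
  have e : (fun t => Real.log |a - t| * kestenMcKayDensity ℓ t) =
      fun t => Real.log (a - t) * kestenMcKayDensity ℓ t := by
    funext t
    rw [Real.log_abs]
  rw [e]
  exact h.mul_continuousOn (continuous_kestenMcKayDensity hℓ).continuousOn

/-- The potential is integration of `log |a - ·|` against the Kesten–McKay / Serre measure:
`U_ℓ(a) = ∫ log |a - t| dμ_ℓ(t)` (`ℓ ≥ 2`). [folklore] -/
theorem kestenMcKayPotential_eq_integral {ℓ : ℕ} (hℓ : 2 ≤ ℓ) (a : ℝ) :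
    kestenMcKayPotential ℓ a = ∫ t, Real.log |a - t| ∂(kestenMcKayMeasure ℓ) := by
  rw [kestenMcKayPotential, integral_kestenMcKayMeasure hℓ]

/-- The potential is even: `U_ℓ(-a) = U_ℓ(a)`. [folklore] -/
theorem kestenMcKayPotential_neg (ℓ : ℕ) (a : ℝ) :
    kestenMcKayPotential ℓ (-a) = kestenMcKayPotential ℓ a := by
  unfold kestenMcKayPotential
  have e : (fun t => Real.log |(-a) - t| * kestenMcKayDensity ℓ t) =
      fun t => (fun s => Real.log |a - s| * kestenMcKayDensity ℓ s) (-t) := by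
    funext t
    simp only [kestenMcKayDensity_neg, sub_neg_eq_add]
    rw [show -a - t = -(a + t) by ring, abs_neg]
  rw [e, intervalIntegral.integral_comp_neg (fun s => Real.log |a - s| * kestenMcKayDensity ℓ s),
    neg_neg]

end Literature.NumberTheory.EllipticCurves.ModularForms
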